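import Literature.MathematicalPhysics.QuantumLattice.HubbardThermalAxisWindow
import Literature.MathematicalPhysics.QuantumLattice.TorusLimitOfMixturesCompactness
import Literature.Computability.AlgebraicComplexity.FixedPointLog
import HarnessLib

/-!
# Kernel reader for «c2-sector» sidecars: a certified-arithmetic evaluator of the type-class pressure floor,
# and the temperature-axis energy windows with every hypothesis discharged except the certificate claim nodes

Family `hubbard` (topic `MathematicalPhysics/QuantumLattice`). The type-class lower bound on the canonical sector
pressure (`TorusSectorPressureTypeBound.lean`, certificate C2) and the two-sided temperature-axis windows built on it
(`HubbardThermalAxisWindow.lean`) consume SECTOR-LEVEL data of an open `a × b` cluster: a finite set `S` of sectors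
`s = (N↑, N↓)`, a balanced integer base type `m : S → ℕ` (`Σ m_s = q`, `Σ m_s N↑_s = Σ m_s N↓_s = A₀`) and certified
floors `0 < z_s ≤ Re Z_β(H^open_{a×b}; s)`, and conclude with the per-site free entropy
`W = (q log q − Σ_s m_s log m_s + Σ_s m_s log z_s)/(q a b)` — a real number built from ~80 logarithms of rationals.

This file makes that data KERNEL-EXECUTABLE. A sidecar is a list of rows `C2Row = (N↑, N↓, m, zn, ze, en, ed)`
(floor `z = zn/2^ze`, with range hints `en`, `ed` for the fixed-point logarithms of `q·zn` and `m·2^ze`), and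

* §1 turns the list into the `(S, m, z)` of the theorems (`c2Sectors`, `c2Type`, `c2Floor`; sums over `S` are list
  sums when the sectors are distinct: `sum_c2Sectors_eq`);
* §2 is the Boolean checker `c2Check P K q A₀ a b rows Wnum Wden` — distinct sectors, positive floors, the balance
  identities, the range hints, and the CERTIFIED ARITHMETIC `Wnum/Wden ≤ W` through the fixed-point logarithm
  enclosures of `Literature/Computability/AlgebraicComplexity/FixedPointLog.lean` (`logRatLo`, soundness
  `logRat_sound_of_inRange`; first-order `ℕ`/`ℤ` code, evaluated by `decide +kernel`) — with its soundness theorem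
  `c2Check_sound` (every hypothesis of `eventually_typeFreeEntropy_mul_sq_le_log_partitionFn` about `(S, m, z)` plus
  `Wnum/Wden ≤ W`);
* §3 the READER THEOREMS a row file applies: `IsTorusLimitOfMixture.meanEnergy_hubbardTTPrime_le_of_c2Check_of_rectMarkovCertificate`
  (C2 sidecar at `β` passing the check + its claim node `∀ r ∈ rows, zn_r/2^ze_r ≤ Re Z_β(box; r)` + a C1 rectangle
  certificate at `β_h < β` ⇒ `e_Φ(ω) ≤ ((c − β_h μ n) − Wnum/Wden)/(β − β_h)`) and the lower-edge twin
  `…le_meanEnergy_hubbardTTPrime_of_c2Check_of_rectMarkovCertificate` (C1 at `β_c > β` ⇒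
  `(Wnum/Wden − (c − β_c μ n))/(β_c − β) ≤ e_Φ(ω)`), for torus limits along box-compatible tori; §4 the
  box-compatibility of the tori `L_j = 8 q' (j + 2)` with `4 × 2` boxes at filling `7/8` (`q = 2q'`, `A₀ = 7q'`).

[cite: Ruelle1969, §3.3] (sub-box trial states); [cite: CoverThomas2006, Theorem 11.1.3] (method of types);
[cite: Israel1979, Lemma II.3.1] (convexity chords); [cite: PoulinHastings2011, eqs. (3)–(8)] (Markov upper bound).
The fixed-point logarithm is [folklore] (Muller, *Elementary Functions*, §4.2). Everything is PROVED; no named fact.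
-/

noncomputable section

namespace Literature.MathematicalPhysics.QuantumLattice

open Matrix Finset HubbardWave0 ThermodynamicLimit LiebThm1 AndersonCluster Literature.Probability.LatticeModels
open Literature.Computability.AlgebraicComplexity.FixedPoint
open _root_.Filter
open scoped _root_.Topology ComplexOrder BigOperators

/-! ### §1 Sidecar rows and the `(S, m, z)` they define -/

/-- One row of a «c2-sector» sidecar: sector `(nu, nd) = (N↑, N↓)`, type multiplicity `m`, floor `zn/2^ze`
(claimed `≤ Re Z_β(box; N↑, N↓)`), and range hints `en`, `ed` (`2^en ≤ q·zn ≤ 2^{en+1}`, `2^ed ≤ m·2^ze ≤ 2^{ed+1}`)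
for the fixed-point logarithms. [cite: CoverThomas2006, Theorem 11.1.3] -/
structure C2Row where
  /-- `N↑` of the sector. -/
  nu : ℕ
  /-- `N↓` of the sector. -/
  nd : ℕ
  /-- multiplicity of the sector in the base type. -/
  m : ℕ
  /-- numerator of the floor `z = zn/2^ze`. -/
  zn : ℕ
  /-- binary exponent of the floor. -/
  ze : ℕ
  /-- range hint for `q · zn`. -/
  en : ℕ
  /-- range hint for `m · 2^ze`. -/
  ed : ℕ
deriving DecidableEq

namespace C2Row

/-- The sector `(N↑, N↓)` of a row. [cite: CoverThomas2006, Theorem 11.1.3] -/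
def sec (r : C2Row) : ℕ × ℕ := (r.nu, r.nd)

/-- The floor `zn/2^ze` of a row, as a real number. [cite: Ruelle1969, §3.3] -/
def floor (r : C2Row) : ℝ := (r.zn : ℝ) / 2 ^ r.ze

/-- Row sanity: `zn > 0`, and either `m = 0` or both range hints are in shape. [folklore] -/
def ok (q : ℕ) (r : C2Row) : Bool :=
  decide (0 < r.zn) && (decide (r.m = 0) || (inRange r.en (q * r.zn) && inRange r.ed (r.m * 2 ^ r.ze)))

/-- Certified lower bound on `2^P · m · log(q z/m)` for a row (`0` if `m = 0`): `m · logRatLo(q·zn, m·2^ze)`.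
[folklore] -/
def termLo (P K q : ℕ) (r : C2Row) : ℤ :=
  if r.m = 0 then 0 else (r.m : ℤ) * logRatLo P K r.en r.ed (q * r.zn) (r.m * 2 ^ r.ze)

/-- The floor of a sane row is positive. [folklore] -/
private theorem floor_pos {q : ℕ} {r : C2Row} (h : r.ok q = true) : 0 < r.floor := by
  unfold ok at h
  simp only [Bool.and_eq_true, decide_eq_true_eq] at h
  unfold floor
  have : (0 : ℝ) < r.zn := by exact_mod_cast h.1
  positivity

/-- **Soundness of the row term**: for a sane row, `termLo ≤ 2^P · m · (log q + log z − log m)`. [folklore] -/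
private theorem termLo_le {P K q : ℕ} (hq : 0 < q) {r : C2Row} (h : r.ok q = true) :
    ((r.termLo P K q : ℤ) : ℝ) ≤
      (2 : ℝ) ^ P * ((r.m : ℝ) * (Real.log q + Real.log r.floor - Real.log r.m)) := by
  unfold ok at h
  simp only [Bool.and_eq_true, decide_eq_true_eq, Bool.or_eq_true] at h
  obtain ⟨hzn, hm⟩ := h
  unfold termLo
  by_cases hm0 : r.m = 0
  · simp [hm0]
  rcases hm with hm | ⟨hen, hed⟩
  · exact absurd hm hm0
  rw [if_neg hm0]
  have hsound := (logRat_sound_of_inRange P K hen hed).1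
  have hqr : (0 : ℝ) < q := by exact_mod_cast hq
  have hznr : (0 : ℝ) < r.zn := by exact_mod_cast hzn
  have hmr : (0 : ℝ) < r.m := by exact_mod_cast Nat.pos_of_ne_zero hm0
  have h2 : (0 : ℝ) < (2 : ℝ) ^ r.ze := by positivity
  have hlog : Real.log (((q * r.zn : ℕ) : ℝ) / ((r.m * 2 ^ r.ze : ℕ) : ℝ)) =
      Real.log q + Real.log r.floor - Real.log r.m := by
    unfold floor
    push_cast
    rw [Real.log_div (by positivity) (by positivity), Real.log_mul hqr.ne' hznr.ne',
      Real.log_mul hmr.ne' h2.ne', Real.log_div hznr.ne' h2.ne']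
    ring
  rw [hlog] at hsound
  push_cast
  have := mul_le_mul_of_nonneg_left hsound hmr.le
  linarith

end C2Row

/-- The sector set `S` of a sidecar. [cite: Ruelle1969, §3.3] -/
def c2Sectors (rows : List C2Row) : Finset (ℕ × ℕ) := (rows.map C2Row.sec).toFinset

/-- The base type `m : ℕ × ℕ → ℕ` of a sidecar (sum of the multiplicities of the rows of that sector; `0` off `S`).
[cite: CoverThomas2006, Theorem 11.1.3] -/
def c2Type (rows : List C2Row) (s : ℕ × ℕ) : ℕ := ((rows.filter fun r => r.sec = s).map C2Row.m).sum

/-- The floor `z : ℕ × ℕ → ℝ` of a sidecar (sum of the floors of the rows of that sector; `0` off `S`).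
[cite: Ruelle1969, §3.3] -/
def c2Floor (rows : List C2Row) (s : ℕ × ℕ) : ℝ := ((rows.filter fun r => r.sec = s).map C2Row.floor).sum

/-- With distinct sectors, the rows of the sector of `r ∈ rows` are exactly `[r]`. [folklore] -/
private theorem filter_sec_eq_singleton {rows : List C2Row} (hnd : (rows.map C2Row.sec).Nodup) {r : C2Row}
    (hr : r ∈ rows) : (rows.filter fun r' => r'.sec = r.sec) = [r] := by
  induction rows with
  | nil => simp at hr
  | cons a l ih =>
    rw [List.map_cons, List.nodup_cons] at hnd
    obtain ⟨ha, hl⟩ := hnd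
    rcases List.mem_cons.1 hr with rfl | hrl
    · rw [List.filter_cons_of_pos (by simp)]
      congr 1
      rw [List.filter_eq_nil_iff]
      intro r' hr' h
      simp only [decide_eq_true_eq] at h
      exact ha (h ▸ List.mem_map.2 ⟨r', hr', rfl⟩)
    · have hne : a.sec ≠ r.sec := fun h => ha (h ▸ List.mem_map.2 ⟨r, hrl, rfl⟩)
      rw [List.filter_cons_of_neg (by simpa using hne)]
      exact ih hl hrl

/-- With distinct sectors, `c2Type rows (sec r) = m_r`. [cite: CoverThomas2006, Theorem 11.1.3] -/
theorem c2Type_sec {rows : List C2Row} (hnd : (rows.map C2Row.sec).Nodup) {r : C2Row} (hr : r ∈ rows) :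
    c2Type rows r.sec = r.m := by
  simp [c2Type, filter_sec_eq_singleton hnd hr]

/-- With distinct sectors, `c2Floor rows (sec r) = zn_r/2^ze_r`. [cite: Ruelle1969, §3.3] -/
theorem c2Floor_sec {rows : List C2Row} (hnd : (rows.map C2Row.sec).Nodup) {r : C2Row} (hr : r ∈ rows) :
    c2Floor rows r.sec = r.floor := by
  simp [c2Floor, filter_sec_eq_singleton hnd hr]

/-- Membership in the sector set. [folklore] -/
private theorem mem_c2Sectors_iff {rows : List C2Row} {s : ℕ × ℕ} : s ∈ c2Sectors rows ↔ ∃ r ∈ rows, r.sec = s := by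
  simp [c2Sectors]

/-- A sector of nonzero type is in `S`. [cite: CoverThomas2006, Theorem 11.1.3] -/
theorem mem_c2Sectors_of_c2Type_ne_zero {rows : List C2Row} {s : ℕ × ℕ} (h : c2Type rows s ≠ 0) :
    s ∈ c2Sectors rows := by
  rw [mem_c2Sectors_iff]
  by_contra hcon
  apply h
  unfold c2Type
  rw [List.filter_eq_nil_iff.2 (fun r hr => ?_)]
  · simp
  · simp only [decide_eq_true_eq]
    exact fun hs => hcon ⟨r, hr, hs⟩

/-- **Sums over the sector set are list sums over the rows** (distinct sectors): for any `G`,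
`Σ_{s ∈ S} G(s, m_s, z_s) = Σ_{r ∈ rows} G(sec r, m_r, z_r)`. [cite: CoverThomas2006, Theorem 11.1.3] -/
theorem sum_c2Sectors_eq {M : Type*} [AddCommMonoid M] {rows : List C2Row} (hnd : (rows.map C2Row.sec).Nodup)
    (G : ℕ × ℕ → ℕ → ℝ → M) :
    ∑ s ∈ c2Sectors rows, G s (c2Type rows s) (c2Floor rows s) = (rows.map fun r => G r.sec r.m r.floor).sum := by
  unfold c2Sectors
  rw [List.sum_toFinset _ hnd, List.map_map]
  congr 1
  apply List.map_congr_left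
  intro r hr
  simp only [Function.comp_apply]
  rw [c2Type_sec hnd hr, c2Floor_sec hnd hr]

/-! ### §2 The checker and its soundness -/

/-- **The sidecar checker.** Precision `P` bits, `K` series terms; base-type size `q`, balance `A₀`, box `a × b`;
claimed floor `Wnum/Wden`. Checks: distinct sectors; every row sane; `q, Wden > 0`; `Σ m = q`; `Σ m N↑ = Σ m N↓ = A₀`;
and the certified arithmetic `Wnum · 2^P q a b ≤ Wden · Σ_r termLo(r)`. First-order `ℕ`/`ℤ` code for `decide +kernel`.
[folklore] -/
def c2Check (P K q A₀ a b : ℕ) (rows : List C2Row) (Wnum : ℤ) (Wden : ℕ) : Bool :=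
  decide ((rows.map C2Row.sec).Nodup) && rows.all (C2Row.ok q) && decide (0 < q) && decide (0 < Wden) &&
    decide ((rows.map C2Row.m).sum = q) && decide ((rows.map fun r => r.m * r.nu).sum = A₀) &&
    decide ((rows.map fun r => r.m * r.nd).sum = A₀) &&
    decide (Wnum * ((2 ^ P * (q * (a * b)) : ℕ) : ℤ) ≤ (Wden : ℤ) * (rows.map (C2Row.termLo P K q)).sum)

/-- Pointwise comparison of list sums. [folklore] -/
private theorem list_sum_map_le {α : Type*} {l : List α} {f g : α → ℝ} (h : ∀ x ∈ l, f x ≤ g x) :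
    (l.map f).sum ≤ (l.map g).sum := by
  induction l with
  | nil => simp
  | cons a l ih =>
    simp only [List.map_cons, List.sum_cons]
    exact add_le_add (h a (by simp)) (ih fun x hx => h x (by simp [hx]))

/-- `Σ_r m_r · c = (Σ_r m_r) · c` over a list (real form). [folklore] -/
private theorem list_sum_map_natCast_mul (rows : List C2Row) (c : ℝ) :
    (rows.map fun r => (r.m : ℝ) * c).sum = ((rows.map C2Row.m).sum : ℕ) * c := by
  induction rows with
  | nil => simp
  | cons a l ih => simp [List.sum_cons, ih, add_mul]

/-- `Σ f − Σ g + Σ h = Σ (f + h − g)` over a list. [folklore] -/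
private theorem list_sum_map_combine {α : Type*} (l : List α) (f g h : α → ℝ) :
    (l.map f).sum - (l.map g).sum + (l.map h).sum = (l.map fun x => f x + h x - g x).sum := by
  induction l with
  | nil => simp
  | cons a l ih =>
    simp only [List.map_cons, List.sum_cons]
    rw [← ih]
    ring

/-- `Σ (c · f) = c · Σ f` over a list. [folklore] -/
private theorem list_sum_map_const_mul {α : Type*} (l : List α) (c : ℝ) (f : α → ℝ) :
    (l.map fun x => c * f x).sum = c * (l.map f).sum := by
  induction l with
  | nil => simp
  | cons a l ih =>
    simp only [List.map_cons, List.sum_cons]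
    rw [ih]
    ring

/-- **Soundness of the checker.** If `c2Check P K q A₀ a b rows Wnum Wden = true` then, with `S = c2Sectors rows`,
`m = c2Type rows`, `z = c2Floor rows`: the sectors are distinct, `q ≥ 1`, `m_s ≠ 0 → s ∈ S`, `Σ_S m = q`,
`Σ_S m_s N↑_s = Σ_S m_s N↓_s = A₀`, `0 < z_s` on `S`, and the certified arithmetic
`Wnum/Wden ≤ (q log q − Σ_S m_s log m_s + Σ_S m_s log z_s)/(q a b)`.
[cite: CoverThomas2006, Theorem 11.1.3] [cite: Ruelle1969, §3.3] -/
theorem c2Check_sound {P K q A₀ a b : ℕ} {rows : List C2Row} {Wnum : ℤ} {Wden : ℕ}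
    (h : c2Check P K q A₀ a b rows Wnum Wden = true) (ha : 1 ≤ a) (hb : 1 ≤ b) :
    (rows.map C2Row.sec).Nodup ∧ 1 ≤ q ∧ (∀ s, c2Type rows s ≠ 0 → s ∈ c2Sectors rows) ∧
      (∑ s ∈ c2Sectors rows, c2Type rows s = q) ∧ (∑ s ∈ c2Sectors rows, c2Type rows s * s.1 = A₀) ∧
      (∑ s ∈ c2Sectors rows, c2Type rows s * s.2 = A₀) ∧ (∀ s ∈ c2Sectors rows, 0 < c2Floor rows s) ∧
      ((Wnum : ℝ) / Wden ≤ ((q : ℝ) * Real.log q - ∑ s ∈ c2Sectors rows, (c2Type rows s : ℝ) * Real.log (c2Type rows s) +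
        ∑ s ∈ c2Sectors rows, (c2Type rows s : ℝ) * Real.log (c2Floor rows s)) / ((q : ℝ) * a * b)) := by
  unfold c2Check at h
  simp only [Bool.and_eq_true, decide_eq_true_eq, List.all_eq_true] at h
  obtain ⟨⟨⟨⟨⟨⟨⟨hnd, hok⟩, hq⟩, hWden⟩, hsum⟩, hA⟩, hB⟩, harith⟩ := h
  have hsumS : ∑ s ∈ c2Sectors rows, c2Type rows s = q := by
    rw [sum_c2Sectors_eq hnd (fun _ m _ => m), ← hsum]
  have hAS : ∑ s ∈ c2Sectors rows, c2Type rows s * s.1 = A₀ := by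
    rw [sum_c2Sectors_eq hnd (fun s m _ => m * s.1), ← hA]; rfl
  have hBS : ∑ s ∈ c2Sectors rows, c2Type rows s * s.2 = A₀ := by
    rw [sum_c2Sectors_eq hnd (fun s m _ => m * s.2), ← hB]; rfl
  have hz0 : ∀ s ∈ c2Sectors rows, 0 < c2Floor rows s := by
    intro s hs
    obtain ⟨r, hr, rfl⟩ := mem_c2Sectors_iff.1 hs
    rw [c2Floor_sec hnd hr]
    exact C2Row.floor_pos (hok r hr)
  refine ⟨hnd, hq, fun s hs => mem_c2Sectors_of_c2Type_ne_zero hs, hsumS, hAS, hBS, hz0, ?_⟩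
  -- the arithmetic
  have hqr : (0 : ℝ) < q := by exact_mod_cast hq
  have hWr : (0 : ℝ) < Wden := by exact_mod_cast hWden
  have har : (0 : ℝ) < a := by exact_mod_cast ha
  have hbr : (0 : ℝ) < b := by exact_mod_cast hb
  have h2P : (0 : ℝ) < (2 : ℝ) ^ P := by positivity
  -- numerator as a list sum
  have hnum : (q : ℝ) * Real.log q - ∑ s ∈ c2Sectors rows, (c2Type rows s : ℝ) * Real.log (c2Type rows s) +
      ∑ s ∈ c2Sectors rows, (c2Type rows s : ℝ) * Real.log (c2Floor rows s) =
      (rows.map fun r => (r.m : ℝ) * (Real.log q + Real.log r.floor - Real.log r.m)).sum := by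
    rw [sum_c2Sectors_eq hnd (fun _ m _ => (m : ℝ) * Real.log m),
      sum_c2Sectors_eq hnd (fun _ m z => (m : ℝ) * Real.log z)]
    have hq' : (q : ℝ) * Real.log q = (rows.map fun r => (r.m : ℝ) * Real.log q).sum := by
      rw [list_sum_map_natCast_mul, hsum]
    rw [hq', list_sum_map_combine]
    refine congrArg _ (List.map_congr_left fun r _ => by ring)
  -- the certified lower bound on `2^P ·` numerator
  have hterm : (((rows.map (C2Row.termLo P K q)).sum : ℤ) : ℝ) ≤
      (2 : ℝ) ^ P * (rows.map fun r => (r.m : ℝ) * (Real.log q + Real.log r.floor - Real.log r.m)).sum := by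
    rw [Int.cast_list_sum, List.map_map, ← list_sum_map_const_mul]
    exact list_sum_map_le fun r hr => by simpa using C2Row.termLo_le hq (hok r hr)
  have harith' : (Wnum : ℝ) * ((2 : ℝ) ^ P * (q * (a * b))) ≤
      (Wden : ℝ) * (((rows.map (C2Row.termLo P K q)).sum : ℤ) : ℝ) := by
    have := harith
    exact_mod_cast this
  rw [hnum, div_le_div_iff₀ hWr (by positivity)]
  have hW0 : (0 : ℝ) ≤ Wden := hWr.le
  nlinarith [mul_le_mul_of_nonneg_left hterm hW0, harith']

/-- **Claim-node transfer**: if every row's floor is certified, `∀ r ∈ rows, zn_r/2^ze_r ≤ F(N↑_r, N↓_r)`, then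
`z_s ≤ F s` on `S` (distinct sectors). [cite: Ruelle1969, §3.3] -/
theorem c2Floor_le_of_rows {rows : List C2Row} (hnd : (rows.map C2Row.sec).Nodup) {F : ℕ × ℕ → ℝ}
    (hnode : ∀ r ∈ rows, r.floor ≤ F r.sec) : ∀ s ∈ c2Sectors rows, c2Floor rows s ≤ F s := by
  intro s hs
  obtain ⟨r, hr, rfl⟩ := mem_c2Sectors_iff.1 hs
  rw [c2Floor_sec hnd hr]
  exact hnode r hr

/-! ### §3 The reader theorems: temperature-axis windows from a checked sidecar and a C1 certificate -/

namespace InfVolFermionState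

variable {t U n β : ℝ} {ω : InfVolFermionState 2} {Ls : ℕ → ℕ}

/-- **Upper edge from a checked «c2-sector» sidecar at `β` and a C1 rectangle certificate at `β_h < β`.**
`ω` a torus limit of the canonical sector Gibbs states at `β` along box-compatible tori (`Ls j = K_x a = K_y b`,
`K_x K_y = R q`, `halfRectN n (Ls j) = R A₀`); sidecar `rows` for the open `a × b` box passing
`c2Check P K q A₀ a b rows Wnum Wden`, with its CLAIM NODE `∀ r ∈ rows, zn_r/2^ze_r ≤ Re Z_β(H^open_{a×b}; N↑_r, N↓_r)`;
C1 data on `rectWindow a' b'` at `(β_h, μ)` with constant `c`. Then `e_Φ(ω) ≤ ((c − β_h μ n) − Wnum/Wden)/(β − β_h)`.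
[cite: Israel1979, Lemma II.3.1] [cite: PoulinHastings2011, eqs. (3)–(8)] [cite: Ruelle1969, §3.3] -/
theorem IsTorusLimitOfMixture.meanEnergy_hubbardTTPrime_le_of_c2Check_of_rectMarkovCertificate
    (hn0 : 0 ≤ n) (hn2 : n ≤ 2)
    (h : ω.IsTorusLimitOfMixture (sectorGibbsCount n) (fun L => sectorGibbsWeightTT' β t 0 U n L)
      (fun L => sectorGibbsVectorTT' t 0 U n L) Ls)
    (hLs : Tendsto Ls atTop atTop) {βh : ℝ} (hβh : 0 < βh) (hlt : βh < β)
    -- C2 sidecar at `β`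
    {a b : ℕ} (ha : 1 ≤ a) (hb : 1 ≤ b) {rows : List C2Row} {P K q A₀ : ℕ} {Wnum : ℤ} {Wden : ℕ}
    (hcheck : c2Check P K q A₀ a b rows Wnum Wden = true)
    (hnode : ∀ r ∈ rows, r.floor ≤ (partitionFn β (spinSectorHamiltonian r.nu r.nd (hubbardOpenBoxTT' a b t 0 U))).re)
    (hbox : ∀ᶠ j in atTop, ∃ R Kx Ky : ℕ, 2 ≤ Kx ∧ 2 ≤ Ky ∧ Ls j = Kx * a ∧ Ls j = Ky * b ∧
      Kx * Ky = R * q ∧ halfRectN n (Ls j) = R * A₀)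
    -- C1 at `βh`
    (μ : ℝ) {a' b' : ℕ} (ha' : 2 ≤ a') (hb' : 2 ≤ b')
    {ι : Type*} (sι : Finset ι) (Sw : ι → Finset (Site 2)) (hS : ∀ i, Sw i ⊆ rectWindow a' b') (zw : ι → Site 2)
    (hzw : ∀ i, shiftSet (zw i) (Sw i) ⊆ rectWindow a' b') {O : ∀ i, FermionOp (Sw i)}
    (hO : ∀ i ∈ sι, (O i).IsHermitian) (g : ι → ℝ)
    {LB : FermionOp ((rectWindow a' b').erase (mkSite2 (a' - 1) (b' - 1)))} (hLB : LB.IsHermitian) {c : ℝ}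
    (hcert : ((Real.exp c : ℂ) • cfc Real.exp LB -
      fermionPartialTrace (PolySite.incl (Finset.erase_subset (mkSite2 (a' - 1) (b' - 1)) (rectWindow a' b')))
        (cfc Real.exp (-((βh : ℂ) • (cornerEnergyRep (rectWindow a' b') (mkSite2 (a' - 1) (b' - 1)) t U μ +
            windowAnnihilator sι (rectWindow a' b') Sw hS zw hzw O g)) +
          fermionEmbed (PolySite.incl (Finset.erase_subset (mkSite2 (a' - 1) (b' - 1)) (rectWindow a' b'))) LB))).PosSemidef) :
    ω.meanEnergy (hubbardTTPrimeFermionInteraction t 0 U) 1 ≤ ((c - βh * μ * n) - (Wnum : ℝ) / Wden) / (β - βh) := by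
  obtain ⟨hnd, hq, hmS, hsum, hA, hB, hz0, harith⟩ := c2Check_sound hcheck ha hb
  have hz := c2Floor_le_of_rows hnd
    (F := fun s => (partitionFn β (spinSectorHamiltonian s.1 s.2 (hubbardOpenBoxTT' a b t 0 U))).re)
    (fun r hr => hnode r hr)
  have hmain := h.meanEnergy_hubbardTTPrime_le_of_typeClass_of_rectMarkovCertificate hn0 hn2 hLs hβh hlt ha hb
    (c2Sectors rows) (c2Type rows) hq hmS hsum hA hB hz0 hz hbox μ ha' hb' sι Sw hS zw hzw hO g hLB hcert
  refine hmain.trans (div_le_div_of_nonneg_right ?_ (by linarith))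
  linarith

/-- **Lower edge from a checked «c2-sector» sidecar at `β` and a C1 rectangle certificate at `β_c > β`** (same
data with the C1 certificate at `(β_c, μ)`): `(Wnum/Wden − (c − β_c μ n))/(β_c − β) ≤ e_Φ(ω)`.
[cite: Israel1979, Lemma II.3.1] [cite: PoulinHastings2011, eqs. (3)–(8)] [cite: Ruelle1969, §3.3] -/
theorem IsTorusLimitOfMixture.le_meanEnergy_hubbardTTPrime_of_c2Check_of_rectMarkovCertificate
    (hn0 : 0 ≤ n) (hn2 : n ≤ 2)
    (h : ω.IsTorusLimitOfMixture (sectorGibbsCount n) (fun L => sectorGibbsWeightTT' β t 0 U n L)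
      (fun L => sectorGibbsVectorTT' t 0 U n L) Ls)
    (hLs : Tendsto Ls atTop atTop) (hβ : 0 < β) {βc : ℝ} (hlt : β < βc)
    -- C2 sidecar at `β`
    {a b : ℕ} (ha : 1 ≤ a) (hb : 1 ≤ b) {rows : List C2Row} {P K q A₀ : ℕ} {Wnum : ℤ} {Wden : ℕ}
    (hcheck : c2Check P K q A₀ a b rows Wnum Wden = true)
    (hnode : ∀ r ∈ rows, r.floor ≤ (partitionFn β (spinSectorHamiltonian r.nu r.nd (hubbardOpenBoxTT' a b t 0 U))).re)
    (hbox : ∀ᶠ j in atTop, ∃ R Kx Ky : ℕ, 2 ≤ Kx ∧ 2 ≤ Ky ∧ Ls j = Kx * a ∧ Ls j = Ky * b ∧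
      Kx * Ky = R * q ∧ halfRectN n (Ls j) = R * A₀)
    -- C1 at `βc`
    (μ : ℝ) {a' b' : ℕ} (ha' : 2 ≤ a') (hb' : 2 ≤ b')
    {ι : Type*} (sι : Finset ι) (Sw : ι → Finset (Site 2)) (hS : ∀ i, Sw i ⊆ rectWindow a' b') (zw : ι → Site 2)
    (hzw : ∀ i, shiftSet (zw i) (Sw i) ⊆ rectWindow a' b') {O : ∀ i, FermionOp (Sw i)}
    (hO : ∀ i ∈ sι, (O i).IsHermitian) (g : ι → ℝ)
    {LB : FermionOp ((rectWindow a' b').erase (mkSite2 (a' - 1) (b' - 1)))} (hLB : LB.IsHermitian) {c : ℝ}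
    (hcert : ((Real.exp c : ℂ) • cfc Real.exp LB -
      fermionPartialTrace (PolySite.incl (Finset.erase_subset (mkSite2 (a' - 1) (b' - 1)) (rectWindow a' b')))
        (cfc Real.exp (-((βc : ℂ) • (cornerEnergyRep (rectWindow a' b') (mkSite2 (a' - 1) (b' - 1)) t U μ +
            windowAnnihilator sι (rectWindow a' b') Sw hS zw hzw O g)) +
          fermionEmbed (PolySite.incl (Finset.erase_subset (mkSite2 (a' - 1) (b' - 1)) (rectWindow a' b'))) LB))).PosSemidef) :
    ((Wnum : ℝ) / Wden - (c - βc * μ * n)) / (βc - β) ≤ ω.meanEnergy (hubbardTTPrimeFermionInteraction t 0 U) 1 := by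
  obtain ⟨hnd, hq, hmS, hsum, hA, hB, hz0, harith⟩ := c2Check_sound hcheck ha hb
  have hz := c2Floor_le_of_rows hnd
    (F := fun s => (partitionFn β (spinSectorHamiltonian s.1 s.2 (hubbardOpenBoxTT' a b t 0 U))).re)
    (fun r hr => hnode r hr)
  have hmain := h.le_meanEnergy_hubbardTTPrime_of_typeClass_of_rectMarkovCertificate hn0 hn2 hLs hβ hlt ha hb
    (c2Sectors rows) (c2Type rows) hq hmS hsum hA hB hz0 hz hbox μ ha' hb' sι Sw hS zw hzw hO g hLB hcert
  refine le_trans (div_le_div_of_nonneg_right ?_ (by linarith)) hmain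
  linarith

end InfVolFermionState

/-! ### §4 Box-compatible tori for `4 × 2` boxes at filling `7/8` -/

/-- **The tori `L_j = 8 q' (j + 2)` are built of `K_x × K_y = 2q'(j+2) × 4q'(j+2)` open `4 × 2` boxes carrying
`R = 4 q' (j+2)²` copies of a base type of size `q = 2q'` with `A₀ = 7q'` electrons of each spin** — the hypothesis
`hbox` of the C2 theorems at `n = 7/8` (`halfRectN (7/8) (8q'(j+2)) = 28 q'² (j+2)²`). [cite: LeBlancEtAl2015, eq. (1)] -/
theorem eventually_box_four_two_seven_eighths {q' : ℕ} (hq' : 1 ≤ q') :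
    ∀ᶠ j : ℕ in atTop, ∃ R Kx Ky : ℕ, 2 ≤ Kx ∧ 2 ≤ Ky ∧ 8 * q' * (j + 2) = Kx * 4 ∧ 8 * q' * (j + 2) = Ky * 2 ∧
      Kx * Ky = R * (2 * q') ∧ halfRectN (7 / 8) (8 * q' * (j + 2)) = R * (7 * q') := by
  refine Eventually.of_forall fun j => ⟨4 * q' * (j + 2) ^ 2, 2 * q' * (j + 2), 4 * q' * (j + 2), ?_, ?_, by ring,
    by ring, by ring, ?_⟩
  · nlinarith
  · nlinarith
  · rw [show 8 * q' * (j + 2) = 4 * (2 * q' * (j + 2)) by ring, halfRectN_seven_eighths_four_mul]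
    ring

/-- The tori `L_j = 8 q' (j + 2)` exhaust the plane (`L_j → ∞`, the torus-limit convention of the box-built rows at filling
`7/8`). [cite: LeBlancEtAl2015, eq. (1)] -/
theorem tendsto_eight_mul_mul_add_two {q' : ℕ} (hq' : 1 ≤ q') :
    Tendsto (fun j : ℕ => 8 * q' * (j + 2)) atTop atTop := by
  refine tendsto_atTop_mono (fun j => ?_) tendsto_id
  simp only [id]
  nlinarith

/-! ### §5 Box-compatibility along ANY sequence of tori divisible by `8q'` (subsequence-stable form) -/

/-- **Every `Ls → ∞` with `8q' ∣ L_j` eventually is box-compatible** (`4 × 2` boxes, base type of size `q = 2q'`,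
`A₀ = 7q'`, filling `7/8`): `L_j = 8q'k` gives `K_x = 2q'k`, `K_y = 4q'k`, `R = 4q'k²`, `halfRectN (7/8) L_j = 28 q'² k²`.
This form of `hbox` is stable under passing to subsequences. [cite: LeBlancEtAl2015, eq. (1)] -/
theorem eventually_box_four_two_seven_eighths_of_dvd {q' : ℕ} (hq' : 1 ≤ q') {Ls : ℕ → ℕ}
    (hLs : Tendsto Ls atTop atTop) (hdvd : ∀ᶠ j in atTop, 8 * q' ∣ Ls j) :
    ∀ᶠ j : ℕ in atTop, ∃ R Kx Ky : ℕ, 2 ≤ Kx ∧ 2 ≤ Ky ∧ Ls j = Kx * 4 ∧ Ls j = Ky * 2 ∧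
      Kx * Ky = R * (2 * q') ∧ halfRectN (7 / 8) (Ls j) = R * (7 * q') := by
  filter_upwards [hdvd, hLs.eventually_ge_atTop 1] with j hj hj1
  obtain ⟨k, hk⟩ := hj
  have hk1 : 1 ≤ k := by
    rcases Nat.eq_zero_or_pos k with h0 | h0
    · rw [h0, mul_zero] at hk; omega
    · exact h0
  refine ⟨4 * q' * k ^ 2, 2 * q' * k, 4 * q' * k, by nlinarith, by nlinarith, by rw [hk]; ring, by rw [hk]; ring,
    by ring, ?_⟩
  rw [hk, show 8 * q' * k = 4 * (2 * q' * k) by ring, halfRectN_seven_eighths_four_mul]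
  ring

/-! ### §6 Transfer of cell edges along the temperature axis (compactness + antitonicity) -/

namespace InfVolFermionState

variable {t t' U n : ℝ}

/-- **An upper edge certified at `β₁` holds at every colder `β ≥ β₁`.** Let `P` be a property of sequences of
tori stable under subsequences (e.g. `∀ᶠ j, d ∣ L_j`). If EVERY torus limit of the canonical sector Gibbs states at
`β₁ > 0` along every `Ls → ∞` with `P Ls` has `e_Φ ≤ hi`, then so does every torus limit at any `β ≥ β₁` along any
such `Ls`: pass to a subsequence along which the `β₁`-states converge (`exists_isTorusLimitOfMixture_sectorGibbs_subseq`)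
and use antitonicity in `β` (`…anti_of_sectorGibbs`). [cite: Ruelle1969, §2.5–2.6] [cite: Israel1979, §I.3 eq. (26)] -/
theorem IsTorusLimitOfMixture.meanEnergy_hubbardTTPrime_le_of_forall_at_hotter (hn0 : 0 ≤ n) (hn2 : n ≤ 2)
    {P : (ℕ → ℕ) → Prop} (hP : ∀ (Ls : ℕ → ℕ) (φ : ℕ → ℕ), P Ls → StrictMono φ → P (Ls ∘ φ))
    {β₁ β hi : ℝ} (hβ₁ : 0 < β₁) (hle : β₁ ≤ β)
    (hcap : ∀ (ω₁ : InfVolFermionState 2) (Ls : ℕ → ℕ), Tendsto Ls atTop atTop → P Ls →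
      ω₁.IsTorusLimitOfMixture (sectorGibbsCount n) (fun L => sectorGibbsWeightTT' β₁ t t' U n L)
        (fun L => sectorGibbsVectorTT' t t' U n L) Ls →
      ω₁.meanEnergy (hubbardTTPrimeFermionInteraction t t' U) 1 ≤ hi)
    {ω : InfVolFermionState 2} {Ls : ℕ → ℕ} (hLs : Tendsto Ls atTop atTop) (hPLs : P Ls)
    (h : ω.IsTorusLimitOfMixture (sectorGibbsCount n) (fun L => sectorGibbsWeightTT' β t t' U n L)
      (fun L => sectorGibbsVectorTT' t t' U n L) Ls) :
    ω.meanEnergy (hubbardTTPrimeFermionInteraction t t' U) 1 ≤ hi := by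
  obtain ⟨φ, hφ, ω₁, h₁⟩ := exists_isTorusLimitOfMixture_sectorGibbs_subseq t t' U hn0 hn2 β₁ hLs
  have hLφ : Tendsto (Ls ∘ φ) atTop atTop := hLs.comp hφ.tendsto_atTop
  have hω : ω.IsTorusLimitOfMixture (sectorGibbsCount n) (fun L => sectorGibbsWeightTT' β t t' U n L)
      (fun L => sectorGibbsVectorTT' t t' U n L) (Ls ∘ φ) := h.comp_tendsto hφ.tendsto_atTop
  exact (h₁.meanEnergy_hubbardTTPrime_anti_of_sectorGibbs hn0 hn2 hβ₁ hle hω hLφ).trans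
    (hcap ω₁ (Ls ∘ φ) hLφ (hP Ls φ hPLs hφ) h₁)

/-- **A lower edge certified at `β₂` holds at every hotter `0 < β ≤ β₂`** (same mechanism, the cold end).
[cite: Ruelle1969, §2.5–2.6] [cite: Israel1979, §I.3 eq. (26)] -/
theorem IsTorusLimitOfMixture.le_meanEnergy_hubbardTTPrime_of_forall_at_colder (hn0 : 0 ≤ n) (hn2 : n ≤ 2)
    {P : (ℕ → ℕ) → Prop} (hP : ∀ (Ls : ℕ → ℕ) (φ : ℕ → ℕ), P Ls → StrictMono φ → P (Ls ∘ φ))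
    {β₂ β lo : ℝ} (hβ : 0 < β) (hle : β ≤ β₂)
    (hfloor : ∀ (ω₂ : InfVolFermionState 2) (Ls : ℕ → ℕ), Tendsto Ls atTop atTop → P Ls →
      ω₂.IsTorusLimitOfMixture (sectorGibbsCount n) (fun L => sectorGibbsWeightTT' β₂ t t' U n L)
        (fun L => sectorGibbsVectorTT' t t' U n L) Ls →
      lo ≤ ω₂.meanEnergy (hubbardTTPrimeFermionInteraction t t' U) 1)
    {ω : InfVolFermionState 2} {Ls : ℕ → ℕ} (hLs : Tendsto Ls atTop atTop) (hPLs : P Ls)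
    (h : ω.IsTorusLimitOfMixture (sectorGibbsCount n) (fun L => sectorGibbsWeightTT' β t t' U n L)
      (fun L => sectorGibbsVectorTT' t t' U n L) Ls) :
    lo ≤ ω.meanEnergy (hubbardTTPrimeFermionInteraction t t' U) 1 := by
  obtain ⟨φ, hφ, ω₂, h₂⟩ := exists_isTorusLimitOfMixture_sectorGibbs_subseq t t' U hn0 hn2 β₂ hLs
  have hLφ : Tendsto (Ls ∘ φ) atTop atTop := hLs.comp hφ.tendsto_atTop
  have hω : ω.IsTorusLimitOfMixture (sectorGibbsCount n) (fun L => sectorGibbsWeightTT' β t t' U n L)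
      (fun L => sectorGibbsVectorTT' t t' U n L) (Ls ∘ φ) := h.comp_tendsto hφ.tendsto_atTop
  exact (hfloor ω₂ (Ls ∘ φ) hLφ (hP Ls φ hPLs hφ) h₂).trans
    (hω.meanEnergy_hubbardTTPrime_anti_of_sectorGibbs hn0 hn2 hβ hle h₂ hLφ)

end InfVolFermionState

/-- The divisibility property `∀ᶠ j, d ∣ L_j` is stable under subsequences (the `P` of §6 for box-built rows).
[cite: LeBlancEtAl2015, eq. (1)] -/
theorem eventually_dvd_comp_of_strictMono {d : ℕ} {Ls : ℕ → ℕ} (φ : ℕ → ℕ) (h : ∀ᶠ j in atTop, d ∣ Ls j)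
    (hφ : StrictMono φ) : ∀ᶠ j in atTop, d ∣ (Ls ∘ φ) j :=
  hφ.tendsto_atTop.eventually h

end Literature.MathematicalPhysics.QuantumLattice

end
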